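import Mathlib.RingTheory.MvPolynomial.Basic
import Mathlib.Algebra.MvPolynomial.Variables
import Mathlib.Algebra.MvPolynomial.Degrees
import Mathlib.Data.Finsupp.Weight
import HarnessLib

/-!
# Multilinear representation of polynomials (reduction modulo the Boolean axioms)

Toolkit for the polynomial calculus in multilinear representation (Clegg–Edmonds–Impagliazzo 1996,
Impagliazzo–Pudlák–Sgall 1999: "because of the axioms `x² - x` we may assume that all polynomials
are multilinear") and for the SIZE–DEGREE trade-off of Impagliazzo–Pudlák–Sgall
(`PolynomialCalculusSizeDegree.lean`; Krajíček 2019, Thm. 16.2.4), companion of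
`PolynomialCalculus.lean` (Krajíček's PC/F, `PC.DerivableInDegree`).  Purely algebraic:

* `MLPC.mlMon s` — the multilinear part of an exponent vector (`x^s ↦ ∏_{i ∈ supp s} x_i`,
  exponents capped at `1`); `MLPC.ml K` — the MULTILINEARISATION operator on `MvPolynomial σ K`
  (the `K`-linear map `x^s ↦ x^{mlMon s}`, i.e. the normal form modulo the Boolean axioms
  `x_i² - x_i`); multilinearity of `p` is expressed throughout as `ml K p = p`.
* API: `ml` on monomials / as a sum, coefficients and support of `ml p`, idempotence,
  `ml (ml p * q) = ml (p * q)`, `ml` kills multiples of `x_j² - x_j`, degrees (`deg (ml p) ≤ deg p`;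
  in a multilinear polynomial the degree of a monomial is its number of variables).
* The `0/1` restrictions `x_j := b` and their interaction with `ml` are in
  `PolynomialCalculusRestriction.lean`; the calculus itself (multiplication by variables, lines in
  multilinear form) and its degree bridge to `PC.DerivableInDegree` in
  `PolynomialCalculusVariableRule.lean`.

References: M. Clegg, J. Edmonds, R. Impagliazzo, *Using the Groebner basis algorithm to find
proofs of unsatisfiability*, Proc. 28th STOC (1996) 174–183, §2; R. Impagliazzo, P. Pudlák,
J. Sgall, *Lower bounds for the polynomial calculus and the Gröbner basis algorithm*, Comput.
Complexity 8 (1999) 127–144, §2 and §6 [ImpagliazzoPudlakSgall1999]; J. Krajíček, *Proof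
Complexity* (CUP 2019) §6.2, Thm. 16.2.4 [KrajicekProofComplexity2019].

Design notes: no new proof system here; `σ` arbitrary (no finiteness), `K` a field (as in
`PolynomialCalculus.lean`).  Mathlib has no multilinearisation operator for `MvPolynomial`
(`lean search multilinear` finds only circuit-side notions under `AlgebraicComplexity/`).
-/

noncomputable section

namespace Literature.Computability.MetaComplexity.MLPC

open Finset MvPolynomial

variable {σ : Type*} {K : Type*} [Field K]

/-! ### The multilinear part of an exponent vector -/

/-- The MULTILINEAR PART of an exponent vector: every positive exponent is replaced by `1`
(`x^s ↦ ∏_{i ∈ supp s} x_i`, reduction of the monomial modulo `x_i² = x_i`).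
[Impagliazzo–Pudlák–Sgall 1999, §2 (polynomials modulo `x² - x` are multilinear)] [folklore] -/
def mlMon (s : σ →₀ ℕ) : σ →₀ ℕ :=
  s.mapRange (fun e => min e 1) (by simp)

/-- Exponents of the multilinear part. [folklore] -/
@[simp] theorem mlMon_apply (s : σ →₀ ℕ) (i : σ) : mlMon s i = min (s i) 1 :=
  Finsupp.mapRange_apply ..

/-- The multilinear part has the same variables. [folklore] -/
@[simp] theorem support_mlMon (s : σ →₀ ℕ) : (mlMon s).support = s.support := by
  ext i
  simp only [Finsupp.mem_support_iff, mlMon_apply, ne_eq, Nat.min_eq_zero_iff, one_ne_zero,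
    or_false]

/-- `mlMon` is idempotent. [folklore] -/
@[simp] theorem mlMon_mlMon (s : σ →₀ ℕ) : mlMon (mlMon s) = mlMon s := by
  ext i; simp only [mlMon_apply]; omega

/-- `mlMon (mlMon s + t) = mlMon (s + t)`: reducing a factor first does not change the
multilinear part of a product. [folklore] -/
theorem mlMon_mlMon_add (s t : σ →₀ ℕ) : mlMon (mlMon s + t) = mlMon (s + t) := by
  ext i; simp only [mlMon_apply, Finsupp.add_apply]; omega

/-- … and symmetrically. [folklore] -/
theorem mlMon_add_mlMon (s t : σ →₀ ℕ) : mlMon (s + mlMon t) = mlMon (s + t) := by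
  rw [add_comm, mlMon_mlMon_add, add_comm]

/-- `mlMon` commutes with erasing a variable. [folklore] -/
theorem mlMon_erase (j : σ) (s : σ →₀ ℕ) : mlMon (s.erase j) = (mlMon s).erase j := by
  classical
  ext i
  by_cases hij : i = j
  · rw [hij, mlMon_apply, Finsupp.erase_same, Finsupp.erase_same]; rfl
  · rw [mlMon_apply, Finsupp.erase_ne hij, Finsupp.erase_ne hij, mlMon_apply]

/-- An exponent vector is multilinear (`mlMon s = s`) iff all exponents are `≤ 1`. [folklore] -/
theorem mlMon_eq_self_iff (s : σ →₀ ℕ) : mlMon s = s ↔ ∀ i, s i ≤ 1 := by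
  constructor
  · intro h i
    have := congrArg (fun f => f i) h
    simp only [mlMon_apply] at this
    omega
  · intro h
    ext i
    simp only [mlMon_apply]
    exact Nat.min_eq_left (h i)

/-- Mathlib's `totalDegree` measures monomials by `s.sum fun _ e => e`; this is `s.degree`.
[folklore] -/
theorem sum_exponents_eq_degree (s : σ →₀ ℕ) : (s.sum fun _ e => e) = s.degree := by
  rw [Finsupp.degree_apply, Finsupp.sum]

/-- The same for the spelling `s.sum fun _ => id` of `totalDegree_monomial_le`. [folklore] -/
theorem sum_id_eq_degree (s : σ →₀ ℕ) : (s.sum fun _ => id) = s.degree := by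
  rw [Finsupp.degree_apply, Finsupp.sum]; rfl

/-- The degree of a multilinear exponent vector is its number of variables. [folklore] -/
theorem degree_mlMon (s : σ →₀ ℕ) : (mlMon s).degree = s.support.card := by
  rw [Finsupp.degree_apply, support_mlMon, Finset.card_eq_sum_ones]
  refine Finset.sum_congr rfl fun i hi => ?_
  rw [mlMon_apply]
  have : s i ≠ 0 := Finsupp.mem_support_iff.1 hi
  omega

/-- Reducing exponents does not raise the degree. [folklore] -/
theorem degree_mlMon_le (s : σ →₀ ℕ) : (mlMon s).degree ≤ s.degree := by
  rw [Finsupp.degree_apply, Finsupp.degree_apply, support_mlMon]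
  exact Finset.sum_le_sum fun i _ => by rw [mlMon_apply]; exact Nat.min_le_left _ _

/-- For a multilinear exponent vector the degree is the number of variables. [folklore] -/
theorem degree_eq_card_support_of_mlMon_eq {s : σ →₀ ℕ} (h : mlMon s = s) :
    s.degree = s.support.card := by
  conv_lhs => rw [← h]
  exact degree_mlMon s

/-- The number of variables never exceeds the degree. [folklore] -/
theorem card_support_le_degree (s : σ →₀ ℕ) : s.support.card ≤ s.degree := by
  rw [← degree_mlMon]; exact degree_mlMon_le s

/-! ### Multilinearisation of polynomials -/

variable (K) in
/-- The MULTILINEARISATION operator `ml : K[x̄] → K[x̄]`, the `K`-linear map sending the monomial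
`x^s` to `x^{mlMon s}` (the normal form modulo the Boolean axioms `x_i² - x_i`).
[Impagliazzo–Pudlák–Sgall 1999, §2; Krajíček 2019, §6.2] [folklore] -/
def ml : MvPolynomial σ K →ₗ[K] MvPolynomial σ K :=
  (basisMonomials σ K).constr K fun s => monomial (mlMon s) (1 : K)

/-- `ml` on a monomial. [folklore] -/
@[simp] theorem ml_monomial (s : σ →₀ ℕ) (a : K) :
    ml K (monomial s a) = monomial (mlMon s) a := by
  have h1 : ml K (monomial s (1 : K)) = monomial (mlMon s) 1 := by
    have := (basisMonomials σ K).constr_basis K (fun s => monomial (mlMon s) (1 : K)) s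
    rwa [coe_basisMonomials] at this
  rw [show monomial s a = a • monomial s (1 : K) by rw [smul_monomial, smul_eq_mul, mul_one],
    map_smul, h1, smul_monomial, smul_eq_mul, mul_one]

/-- `ml 1 = 1`. [folklore] -/
@[simp] theorem ml_one : ml K (1 : MvPolynomial σ K) = 1 := by
  rw [← C_1, C_apply, ml_monomial]
  congr 1

/-- `ml (C a) = C a`. [folklore] -/
@[simp] theorem ml_C (a : K) : ml K (C a : MvPolynomial σ K) = C a := by
  rw [C_apply, ml_monomial]
  congr 1

/-- A `0/1` exponent vector is multilinear. [folklore] -/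
@[simp] theorem mlMon_single_one (j : σ) : mlMon (Finsupp.single j 1) = Finsupp.single j 1 := by
  classical
  ext i
  rw [mlMon_apply, Finsupp.single_apply]
  split <;> rfl

/-- `ml (X j) = X j`. [folklore] -/
@[simp] theorem ml_X (j : σ) : ml K (X j : MvPolynomial σ K) = X j := by
  rw [X, ml_monomial, mlMon_single_one]

/-- `ml p` as a sum over the monomials of `p`. [folklore] -/
theorem ml_eq_sum (p : MvPolynomial σ K) :
    ml K p = ∑ s ∈ p.support, monomial (mlMon s) (coeff s p) := by
  conv_lhs => rw [p.as_sum, map_sum]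
  exact Finset.sum_congr rfl fun s _ => ml_monomial s _

/-- Coefficients of `ml p`: the coefficient of `t` collects all monomials of `p` with multilinear
part `t`. [folklore] -/
theorem coeff_ml [DecidableEq σ] (p : MvPolynomial σ K) (t : σ →₀ ℕ) :
    coeff t (ml K p) = ∑ s ∈ p.support with mlMon s = t, coeff s p := by
  rw [ml_eq_sum, coeff_sum, Finset.sum_filter]
  exact Finset.sum_congr rfl fun s _ => by rw [coeff_monomial]

/-- The monomials of `ml p` are multilinear parts of monomials of `p`. [folklore] -/
theorem support_ml_subset [DecidableEq σ] (p : MvPolynomial σ K) :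
    (ml K p).support ⊆ p.support.image mlMon := by
  intro t ht
  rw [mem_support_iff, coeff_ml] at ht
  obtain ⟨s, hs, _⟩ := Finset.exists_ne_zero_of_sum_ne_zero ht
  rw [Finset.mem_filter] at hs
  exact Finset.mem_image.2 ⟨s, hs.1, hs.2⟩

/-- The monomials of a MULTILINEAR polynomial — one fixed by `ml` — have exponents `≤ 1`.
(Multilinearity of `p` is expressed throughout as `ml K p = p`.) [Impagliazzo–Pudlák–Sgall 1999,
§2] [folklore] -/
theorem mlMon_eq_of_ml_eq_self {p : MvPolynomial σ K} (h : ml K p = p) {s : σ →₀ ℕ}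
    (hs : s ∈ p.support) : mlMon s = s := by
  classical
  rw [← h] at hs
  obtain ⟨t, _, rfl⟩ := Finset.mem_image.1 (support_ml_subset p hs)
  exact mlMon_mlMon t

/-- Conversely `ml` fixes a polynomial all of whose monomials are multilinear. [folklore] -/
theorem ml_eq_self_of_forall_mlMon_eq {p : MvPolynomial σ K} (h : ∀ s ∈ p.support, mlMon s = s) :
    ml K p = p := by
  rw [ml_eq_sum]
  conv_rhs => rw [p.as_sum]
  exact Finset.sum_congr rfl fun s hs => by rw [h s hs]

/-- `ml` is idempotent: `ml p` is multilinear. [folklore] -/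
@[simp] theorem ml_ml (p : MvPolynomial σ K) : ml K (ml K p) = ml K p := by
  classical
  refine ml_eq_self_of_forall_mlMon_eq fun t ht => ?_
  obtain ⟨s, _, rfl⟩ := Finset.mem_image.1 (support_ml_subset p ht)
  exact mlMon_mlMon s

/-- Multilinearity is inherited by anything with smaller support. [folklore] -/
theorem ml_eq_self_of_support_subset {p q : MvPolynomial σ K} (h : ml K p = p)
    (hq : q.support ⊆ p.support) : ml K q = q :=
  ml_eq_self_of_forall_mlMon_eq fun _ hs => mlMon_eq_of_ml_eq_self h (hq hs)

/-- **`ml (ml p * q) = ml (p * q)`**: a factor may be reduced first. [folklore] -/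
theorem ml_ml_mul (p q : MvPolynomial σ K) : ml K (ml K p * q) = ml K (p * q) := by
  induction p using MvPolynomial.induction_on' with
  | monomial s a =>
    induction q using MvPolynomial.induction_on' with
    | monomial t b =>
      rw [ml_monomial, monomial_mul, monomial_mul, ml_monomial, ml_monomial, mlMon_mlMon_add]
    | add q₁ q₂ ih₁ ih₂ => rw [mul_add, mul_add, map_add, map_add, ih₁, ih₂]
  | add p₁ p₂ ih₁ ih₂ => rw [map_add, add_mul, add_mul, map_add, map_add, ih₁, ih₂]

/-- … and symmetrically `ml (p * ml q) = ml (p * q)`. [folklore] -/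
theorem ml_mul_ml (p q : MvPolynomial σ K) : ml K (p * ml K q) = ml K (p * q) := by
  rw [mul_comm, ml_ml_mul, mul_comm]

/-- `ml` kills multiples of a Boolean axiom: `ml ((X j ^ 2 - X j) * q) = 0`. [folklore] -/
theorem ml_boolAxiom_mul (j : σ) (q : MvPolynomial σ K) :
    ml K ((X j ^ 2 - X j) * q) = 0 := by
  classical
  have hmon : mlMon (Finsupp.single j 1 + Finsupp.single j 1) = Finsupp.single j 1 := by
    ext i
    rw [mlMon_apply, Finsupp.add_apply, Finsupp.single_apply]
    split <;> rfl
  have h : ml K (X j ^ 2 : MvPolynomial σ K) = ml K (X j) := by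
    rw [pow_two, show (X j * X j : MvPolynomial σ K) =
      monomial (Finsupp.single j 1 + Finsupp.single j 1) 1 by rw [X, monomial_mul, mul_one],
      ml_monomial, ml_X, hmon, X]
  rw [← ml_ml_mul, map_sub, h, sub_self, zero_mul, map_zero]

/-- Hence `ml ((1 - X j) * (X j * q)) = 0`. [folklore] -/
theorem ml_one_sub_X_mul_X_mul (j : σ) (q : MvPolynomial σ K) :
    ml K ((1 - X j) * (X j * q)) = 0 := by
  rw [show ((1 : MvPolynomial σ K) - X j) * (X j * q) = (X j ^ 2 - X j) * (-q) by ring]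
  exact ml_boolAxiom_mul j _

/-! ### Degrees -/

/-- Every monomial of `ml p` has degree at most `deg p`. [folklore] -/
theorem totalDegree_ml_le (p : MvPolynomial σ K) : (ml K p).totalDegree ≤ p.totalDegree := by
  classical
  rw [ml_eq_sum]
  refine totalDegree_finsetSum_le fun s hs => (totalDegree_monomial_le _ _).trans ?_
  have h1 : ((mlMon s).sum fun _ => id) = (mlMon s).degree := sum_exponents_eq_degree _
  rw [h1]
  refine (degree_mlMon_le s).trans ?_
  rw [← sum_exponents_eq_degree]
  exact le_totalDegree hs

/-- In a multilinear polynomial, a monomial has as many variables as its degree, so at most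
`deg p` of them. [folklore] -/
theorem card_support_le_totalDegree_of_ml_eq_self {p : MvPolynomial σ K} (h : ml K p = p)
    {s : σ →₀ ℕ} (hs : s ∈ p.support) : s.support.card ≤ p.totalDegree := by
  rw [← degree_eq_card_support_of_mlMon_eq (mlMon_eq_of_ml_eq_self h hs),
    ← sum_exponents_eq_degree]
  exact le_totalDegree hs

/-- Degree of a multilinear polynomial from a bound on the number of variables of its monomials.
[folklore] -/
theorem totalDegree_le_of_ml_eq_self {p : MvPolynomial σ K} (h : ml K p = p) {d : ℕ}
    (hd : ∀ s ∈ p.support, s.support.card ≤ d) : p.totalDegree ≤ d := by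
  rw [totalDegree]
  refine Finset.sup_le fun s hs => ?_
  have := hd s hs
  rwa [← degree_eq_card_support_of_mlMon_eq (mlMon_eq_of_ml_eq_self h hs),
    ← sum_exponents_eq_degree] at this

end Literature.Computability.MetaComplexity.MLPC
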